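import Summits.BirchSwinnertonDyer.Rank1Residual.Additive.TameBranchUpper
import Summits.BirchSwinnertonDyer.Rank1Residual.Additive.PlusSymbolIntegrality
import HarnessLib

/-!
# BSD rank-≤1 residual cell: the typed input `Additive.PlusSymbolsPIntegralAt W p` (census H-2(b),
# the UPPER period-half of the N10/N11 corner) is a THEOREM on every X4 row — JOIN BY NAME

HONEST FRAMING (cell `b2b-bsdres-*`, run/shared/lean/b2b/bsd-rank1-residual/, verbatim): the goal
of the cell is to DELETE the COMBINATION-SHAPED residual classes for ALL analytic-rank `≤ 1` elliptic
curves over `ℚ` — "full BSD formula for every rank `≤ 1` curve in class C" assembled STRICTLY from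
published theorems — so that the rank-`≤ 1` remainder becomes exactly the CONSTRUCTION-SHAPED
classes, which are TYPED (missing-input Props), NOT attempted; this is not "finishing BSD".
Prove what is provable now; shrink each hard class to its core with data; no claim beyond stated
classes.  Research routes; census output = EVIDENCE, never a Literature fact.  Unit
`b2b-bsdres-n1011-p09` (team n1011, OWNERS row **T-R18b**, lead ruling R5-10: "JOIN BY NAME: T-R18b's
conclusion IS `PlusSymbolsPIntegralAt`").  THEOREMS ONLY (no definition, no named fact, no instance).
N10 / N11 labels unchanged; nothing booked.

## What this file does

cc-typer-2's typed input `Additive.PlusSymbolsPIntegralAt W p` (`Additive/TameBranchUpper.lean`: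
"for the newform `f` of `W` and every `x ∈ ℚ`, `|[x]⁺_f|_p ≤ 1`"; its docstring: "holds on 137/142
[census rows], fails exactly on the 5 `p`-isogeny rows … so CONJECTURED on X4 (irreducible `E[p]`) …
a named prover target, not claimed") is DISCHARGED by ROUTE-1 R1-8 (ii) = the kernel theorem
`Additive.norm_ratPlusSymbol_le_one_of_irreducible` (`Additive/PlusSymbolIntegrality.lean`: Drinfeld's
operator `T_ℓ − ℓ − 1` at every cusp, `ℓ ≡ 1 (mod N)` a non-Eisenstein prime from irreducibility,
`p` odd):

* `plusSymbolsPIntegralAt_of_irreducible : p ≠ 2 → Irr(E[p]) → PlusSymbolsPIntegralAt W p`;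
* `plusSymbolsPIntegralAt_of_surj` (`surj(p)`, `p` odd), `plusSymbolsPIntegralAt_of_classX4`
  (`ClassX4 W p = p ≠ 2 ∧ add(p) ∧ irr(p)`: on EVERY X4 pair, so on all of N10 ∩ X4 and N11);
* `plusSymbolsPIntegralAt_iff_padicValRat` — the comparison between the norm currency of the typed
  input and the valuation currency `∀ r, [r]⁺_f ≠ 0 → 0 ≤ ord_p [r]⁺_f` of the `Kim2025` records' `hint`
  binder (same content).
The 5 failing census rows (294a1@7, 450a1@5, 490f1@7, 1200q1@5, 1575k1@5) all have a rational
`p`-isogeny, i.e. REDUCIBLE `E[p]` — consistent: the theorem's hypothesis is exactly irreducibility.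

## References

* V. G. Drinfeld, Funct. Anal. Appl. 7 (1973) 155–156; Ju. I. Manin, Izv. 36 (1972) Cor. 3.6 [Manin1972].
* C. Wuthrich, Doc. Math. 19 (2014) p. 382 [Wuthrich2014]; C.-H. Kim, AJM 148 §1.4.1 [Kim2026AJM].
* Cell files: `cells/n1011/skel/T-R18b.md`; `cells/n1011/PLAN.md` R5-10; `Additive/TameBranchUpper.lean` §4.
-/

noncomputable section

open scoped Classical MatrixGroups ModularForm

open CongruenceSubgroup WeierstrassCurve Literature.NumberTheory.EllipticCurves
  Literature.NumberTheory.EllipticCurves.ModularForms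
  Literature.NumberTheory.EllipticCurves.Rank1Residual

namespace Summit.BirchSwinnertonDyer.Rank1Residual.Additive

variable (W : WeierstrassCurve ℚ) [W.IsElliptic] [W.IsGloballyMinimal] (p : ℕ) [hp : Fact p.Prime]

/-- **`PlusSymbolsPIntegralAt W p` on every irreducible row, `p` odd** (census H-2(b) typed input =
ROUTE-1 R1-8 (ii) kernel theorem): for every newform `f` of `W` and every `x ∈ ℚ`, `|[x]⁺_f|_p ≤ 1`,
by `norm_ratPlusSymbol_le_one_of_irreducible`. [folklore] -/
theorem plusSymbolsPIntegralAt_of_irreducible (hp2 : p ≠ 2) (hirr : W.HasIrreducibleModPGaloisRep p) :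
    PlusSymbolsPIntegralAt W p :=
  fun _ hf x ↦ norm_ratPlusSymbol_le_one_of_irreducible hp2 hf hirr x

/-- Row reading under `surj(p)`, `p` odd (every tower / N11 row). [folklore] -/
theorem plusSymbolsPIntegralAt_of_surj (hp2 : p ≠ 2) (hsurj : W.HasSurjectiveModNGaloisRep p) :
    PlusSymbolsPIntegralAt W p :=
  plusSymbolsPIntegralAt_of_irreducible W p hp2
    (hasIrreducibleModPGaloisRep_of_hasSurjectiveModNGaloisRep W p hsurj)

/-- **Row reading on class X4** (`ClassX4 W p = p ≠ 2 ∧ additive(p) ∧ E[p] irreducible`): the UPPER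
period-half typed input `PlusSymbolsPIntegralAt W p` HOLDS on EVERY X4 pair, whatever the potential
type — so on all of N10 ∩ X4 and all of N11. (The additivity conjunct is not used.) [folklore] -/
theorem plusSymbolsPIntegralAt_of_classX4 (hX : ClassX4 W p) : PlusSymbolsPIntegralAt W p :=
  plusSymbolsPIntegralAt_of_irreducible W p hX.1 hX.2.2

omit [W.IsElliptic] [W.IsGloballyMinimal] in
/-- **Comparison of currencies**: the norm form `PlusSymbolsPIntegralAt W p` (`|[x]⁺_f|_p ≤ 1` for
all `x`, every newform `f` of `W`) is equivalent to the valuation form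
`∀ f, IsNewformOf W f → ∀ r, [r]⁺_f ≠ 0 → 0 ≤ ord_p [r]⁺_f` — the `hint` binder of the `Kim2025`
own-currency records ("`Ω⁺_f` is an integral period", Kim 2025 Def. 2.2) — since for `q ≠ 0`,
`|q|_p = p^{−ord_p q}`. [folklore] -/
theorem plusSymbolsPIntegralAt_iff_padicValRat :
    PlusSymbolsPIntegralAt W p ↔
      ∀ {N : ℕ} [NeZero N] (f : CuspForm (Gamma0 N) 2), IsNewformOf W f →
        ∀ r : ℚ, ratPlusSymbol f r ≠ 0 → 0 ≤ padicValRat p (ratPlusSymbol f r) := by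
  have key : ∀ q : ℚ, ‖((q : ℚ) : ℚ_[p])‖ ≤ 1 ↔ 0 ≤ padicValRat p q := fun q ↦ by
    rw [Padic.norm_le_one_iff_val_nonneg, Padic.valuation_ratCast]
  constructor
  · intro h N _ f hf r _
    exact (key _).mp (h f hf r)
  · intro h N _ f hf x
    by_cases hx : ratPlusSymbol f x = 0
    · rw [hx, Rat.cast_zero, norm_zero]; exact zero_le_one
    · exact (key _).mpr (h f hf x hx)

end Summit.BirchSwinnertonDyer.Rank1Residual.Additive

end
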